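import Summits.HodgeConjecture.HodgeConjecture.Theorems.F0P3bStubT6aDegOneTypePure
import Summits.HodgeConjecture.HodgeConjecture.Theorems.F0P3bGKPairGlue
import Literature.Algebra.Lie.ChevalleyEilenbergLowDegree
import HarnessLib

/-!
# FLOOR-0 P3 — junction J2 (algebraic): in an IRREDUCIBLE `(𝔤, K)`-module of `U(α, β)` a type-`δ` `1`-cochain with
# `𝔭^{−δ}`-null values is CLOSED and its class is NON-ZERO (the converse of ★ T3j, and the class packaging)

Cell hodgecm-mathlib, FLOOR 0, crux item H413 = stmt-HodgeConjecture-24833; integrator brief F0P3-plan (g0) 2026-08-30T23:46:53Z («Q2′: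
the J2-algebraic converse of T3j — the junction piece every rung-1 consumer of T6a ∕ T6b ∕ T6c needs», ENGINE-INTERFACES §7).  PROOF
lane (no `def`); author F0P3-p03 (g2).  Generic `U(α, β)`, `δ = ±1`; hypotheses = `Ad`-compatibility `hV` and `IsIrreducibleGK` only
(no admissibility, unitarity, `K`-finiteness); engine = ★ F0P3-p01 (g2)'s `F0P3bPNullIrreducible.nullWeightSpace_eq_bot_of_ne`.
* §1 (no irreducibility) `lie_apply_sub_mem_nullWeightSpace`: for `f` of type `δ` with `𝔭^{−δ}`-null values and `X, Y ∈ 𝔭`, the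
  DEFECT `a(X, Y) = ρ(X) f(Y) − ρ(Y) f(X)` is again `𝔭^{−δ}`-null, of `z₀`-weight `2δi` (real-frame Jacobi:
  `N_Z a = f(⁅Z, ⁅X, Y⁆⁆) + δi · f(⁅JZ, ⁅X, Y⁆⁆) = −ρ(⁅X, Y⁆) f(Z) · (1 + (δi)²) = 0` — the shadow of `[𝔭^δ, 𝔭^δ] = 0`).
* §2 `d_eq_zero_of_isPNull` (**T3j converse**): `V` irreducible ⇒ such an `f` is CLOSED — `a(X, Y) ∈ T_{2δi}(δi)` while a non-zero
  value `f(X₀) ∈ T_{δi}(δi)`, and an irreducible module has null vectors in ONE weight only; the `(𝔨, ·)`-components of `df`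
  vanish by `𝔨`-equivariance and horizontality.
* §3 `typeClasses_ne_bot_of_isPNull`: `V` irreducible, `f ≠ 0` as above ⇒ `upqTypeClasses … 1 δ ≠ ⊥`: were `f = dv`,
  `v ∈ C⁰(𝔤, K; V)` (`𝔨`-invariant, weight `0`), the type would force `N(𝔭) v = 0`, so `T₀(δi) ≠ 0 ≠ T_{δi}(δi)` — impossible
  (NO unitarity used).
* §4 `exists_gkCochain_of_linearMap`: a real-linear `φ : 𝔤 → V` vanishing on `𝔨`, `K`-equivariant (`ρK(k) φ(X) = φ(Ad k X)`) and
  `𝔨`-equivariant (`φ(⁅W, X⁆) = ρ(W) φ(X)`) IS the value function of a `(𝔤, K)`-1-cochain; `typeClasses_ne_bot_of_linearMap` = the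
  rung-1 junction in one statement (such a non-zero `φ` with `𝔭^{−δ}`-null values of weight `δi` gives `H¹_δ ≠ 0`).
CAVEAT (not formalised): for NON-irreducible `V` §2–§3 fail (generalised-Verma coboundaries `dv`, `v` a null `K`-invariant vector).
References: Borel–Wallach, *Continuous cohomology, discrete subgroups, and representations of reductive groups*, AMS 2000, I §1.1, §5.1,
II §4.1–4.2 [BorelWallach2000]; Knapp–Vogan, *Cohomological induction and unitary representations*, Princeton 1995, §II.4
[KnappVogan1995]; Rogawski, *Automorphic representations of unitary groups in three variables*, Princeton 1990, §15.2 [Rogawski1990].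
HONEST LABEL: HC_CM is proved only modulo the printed citations until rung 0 closes; this file discharges none of them.
-/

-- Mathlib idiom (as in `GKModules`, `GKCohomology`, the `Upq*` files and the Lines file): commutator bracket on `Module.End`
attribute [local instance 100] LieRing.ofAssociativeRing

set_option autoImplicit false
set_option linter.dupNamespace false

noncomputable section

namespace Summit.HodgeConjecture.HodgeConjecture.Cruxes.H413.F0P3PNullMapIsCocycle

open Literature.Algebra.Lie Literature.Algebra.Lie.ChevalleyEilenberg
open Literature.NumberTheory.Automorphic
open Literature.RepresentationTheory.BorelWallach2000
open Literature.RepresentationTheory.KonnoKonno2007 Literature.RepresentationTheory.KonnoKonno2007.RealDualPair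
open Literature.RepresentationTheory.KonnoKonno2007.RealDualPair.UForm
open Summit.HodgeConjecture.HodgeConjecture.Cruxes.H413.F0P3bPPartOperators
open Summit.HodgeConjecture.HodgeConjecture.Cruxes.H413.F0P3bPNullGeneration
open Summit.HodgeConjecture.HodgeConjecture.Cruxes.H413.F0P3bPNullIrreducible
open Summit.HodgeConjecture.HodgeConjecture.Cruxes.H413.F0P3bStubT6aDegOneTypePure
open Summit.HodgeConjecture.HodgeConjecture.Cruxes.H413.F0P3bStubT6kU21PGeometry
open Summit.HodgeConjecture.HodgeConjecture.Cruxes.H413.F0P3bGKPairGlue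

variable {α β : Type} [Fintype α] [DecidableEq α] [Fintype β] [DecidableEq β]
  {V : Type} [AddCommGroup V] [Module ℂ V]
  (ρK : Representation ℂ (uFormGroup α β).maximalCompact V)
  (ρ𝔤 : (uFormGroup α β).lie →ₗ⁅ℝ⁆ Module.End ℂ V)
  (hV : ∀ (k : (uFormGroup α β).maximalCompact) (X : (uFormGroup α β).lie), ρK k ∘ₗ ρ𝔤 X ∘ₗ ρK k⁻¹ =
    ρ𝔤 ((uFormGroup α β).Ad (Subgroup.inclusion (uFormGroup α β).maximalCompact_le_carrier k) X))

/-! ## §0 Small glue -/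

/-- `f(−X) = −f(X)` for a `1`-cochain. [folklore] -/
theorem cochainOne_apply_neg (f : Cochain ℝ (uFormGroup α β).lie (GKCarrier (uFormGroup α β) ρ𝔤) 1)
    (X : (uFormGroup α β).lie) : f ![-X] = -f ![X] := by
  refine eq_neg_of_add_eq_zero_left ?_
  rw [← cochainOne_apply_add ρ𝔤, neg_add_cancel, cochainOne_apply_zero ρ𝔤]

/-- `ρ(A) ρ(B) v = ρ(B) ρ(A) v + ρ(⁅A, B⁆) v` (`ρ𝔤` is a Lie map into `End V` with the commutator bracket).
[cite: BorelWallach2000, I §1.1] -/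
theorem lie_apply_apply (A B : (uFormGroup α β).lie) (v : V) : ρ𝔤 A (ρ𝔤 B v) = ρ𝔤 B (ρ𝔤 A v) + ρ𝔤 ⁅A, B⁆ v := by
  have e := LinearMap.congr_fun (LieHom.map_lie ρ𝔤 A B) v
  rw [Ring.lie_def, LinearMap.sub_apply, Module.End.mul_apply, Module.End.mul_apply] at e
  rw [e]; abel

/-- The nullity operator `pOp μ Z`, `Z ∈ 𝔭`, kills a vector killed by the `pOp μ x_s` of the frame. [cite: BorelWallach2000, II §4.1] -/
theorem pOp_eq_zero_of_frame {μ : ℂ} {v : V} (hv : ∀ s : (α × β) × Fin 2, pOp ρ𝔤 μ (upqPBasis s) v = 0)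
    (Z : (uFormGroup α β).lie) (hZ : Z ∈ pPart α β) : pOp ρ𝔤 μ Z v = 0 := by
  obtain ⟨c, rfl⟩ := exists_sum_upqPBasis_of_mem_pPart Z hZ
  rw [pOp_sum_smul_apply]
  exact Finset.sum_eq_zero fun s _ => by rw [hv s, smul_zero]

/-! ## §1 The defect `ρ(X) f(Y) − ρ(Y) f(X)` of a null type-`δ` cochain is null of weight `2δi` -/

section Defect
variable {δ : ℤ} {f : Cochain ℝ (uFormGroup α β).lie (GKCarrier (uFormGroup α β) ρ𝔤) 1}

include hV in
/-- **Jacobi identity for the defect**: `f(⁅⁅Z, X⁆, Y⁆) − f(⁅⁅Z, Y⁆, X⁆) = −ρ(⁅X, Y⁆) f(Z)` for `X, Y ∈ 𝔭` and a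
`(𝔤, K)`-1-cochain `f` (`⁅X, Y⁆ ∈ 𝔨` acts through `𝔨`-equivariance). [cite: BorelWallach2000, I §5.1 (2)] -/
theorem apply_lie_lie_sub (hfc : f ∈ (gkComplex (uFormGroup α β) ρK ρ𝔤 hV).carrier 1)
    (Z X Y : (uFormGroup α β).lie) (hX : X ∈ pPart α β) (hY : Y ∈ pPart α β) :
    (f ![⁅⁅Z, X⁆, Y⁆] : V) - (f ![⁅⁅Z, Y⁆, X⁆] : V) = -ρ𝔤 ⁅X, Y⁆ (f ![Z] : V) := by
  have hW : ⁅X, Y⁆ ∈ (uFormGroup α β).kInLie := (lie_mem_kInLie_of_mem_pPart X Y hX hY).1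
  have hjac : ⁅⁅Z, X⁆, Y⁆ = ⁅⁅Z, Y⁆, X⁆ + -⁅⁅X, Y⁆, Z⁆ := by
    have e := leibniz_lie Z X Y
    rw [← lie_skew Z ⁅X, Y⁆, ← lie_skew X ⁅Z, Y⁆] at e
    rw [e]; abel
  rw [hjac, cochainOne_apply_add ρ𝔤, cochainOne_apply_neg ρ𝔤, lie_apply_of_mem_kInLie ρK ρ𝔤 hV hfc hW Z]
  abel

include hV in
/-- **The defect is `𝔭^{−δ}`-null** (`δ² = 1`): for `Z, X, Y ∈ 𝔭`,
`N_Z (ρ(X) f(Y) − ρ(Y) f(X)) = f(⁅Z,⁅X,Y⁆⁆) + δi · f(⁅JZ,⁅X,Y⁆⁆) = −(1 + (δi)²) ρ(⁅X,Y⁆) f(Z) = 0`.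
[cite: BorelWallach2000, II §4.1–4.2] -/
theorem pOp_defect_eq_zero (hδ : δ * δ = 1) (hf : f ∈ upqType ρK ρ𝔤 hV 1 δ)
    (hfN : ∀ (Y : Fin 1 → (uFormGroup α β).lie) (s : (α × β) × Fin 2),
      ⁅upqPBasis s, f Y⁆ + ((δ : ℂ) * Complex.I) • ⁅⁅upqZ0 α β, upqPBasis s⁆, f Y⁆ = 0)
    (Z X Y : (uFormGroup α β).lie) (hZ : Z ∈ pPart α β) (hX : X ∈ pPart α β) (hY : Y ∈ pPart α β) :
    pOp ρ𝔤 ((δ : ℂ) * Complex.I) Z (ρ𝔤 X (f ![Y] : V) - ρ𝔤 Y (f ![X] : V)) = 0 := by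
  set μ : ℂ := (δ : ℂ) * Complex.I with hμdef
  have hμ : μ * μ = -1 := deltaI_mul_deltaI hδ
  obtain ⟨hfc, hft⟩ := (mem_upqType_iff ρK ρ𝔤 hV 1 δ f).1 hf
  have hnull : ∀ T : (uFormGroup α β).lie, pOp ρ𝔤 μ Z (f ![T] : V) = 0 := fun T =>
    pOp_eq_zero_of_frame ρ𝔤 (fun s => hfN ![T] s) Z hZ
  have hcomm : ∀ (A : (uFormGroup α β).lie) (v : V), pOp ρ𝔤 μ Z (ρ𝔤 A v) =
      ρ𝔤 A (pOp ρ𝔤 μ Z v) + (ρ𝔤 ⁅Z, A⁆ v + μ • ρ𝔤 ⁅⁅upqZ0 α β, Z⁆, A⁆ v) := by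
    intro A v
    rw [pOp_apply, pOp_apply, lie_apply_apply ρ𝔤 Z A, lie_apply_apply ρ𝔤 ⁅upqZ0 α β, Z⁆ A, map_add, map_smul,
      smul_add]
    abel
  have hJZ : ⁅upqZ0 α β, Z⁆ ∈ pPart α β := lie_upqZ0_mem_pPart Z hZ
  have hXY : ⁅X, Y⁆ ∈ (uFormGroup α β).kInLie := (lie_mem_kInLie_of_mem_pPart X Y hX hY).1
  rw [map_sub, hcomm X, hcomm Y, hnull, hnull, map_zero, map_zero, zero_add, zero_add,
    lie_apply_of_mem_kInLie ρK ρ𝔤 hV hfc (lie_mem_kInLie_of_mem_pPart Z X hZ hX).1 Y,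
    lie_apply_of_mem_kInLie ρK ρ𝔤 hV hfc (lie_mem_kInLie_of_mem_pPart Z Y hZ hY).1 X,
    lie_apply_of_mem_kInLie ρK ρ𝔤 hV hfc (lie_mem_kInLie_of_mem_pPart _ X hJZ hX).1 Y,
    lie_apply_of_mem_kInLie ρK ρ𝔤 hV hfc (lie_mem_kInLie_of_mem_pPart _ Y hJZ hY).1 X]
  have e1 := apply_lie_lie_sub ρK ρ𝔤 hV hfc Z X Y hX hY
  have e2 := apply_lie_lie_sub ρK ρ𝔤 hV hfc ⁅upqZ0 α β, Z⁆ X Y hX hY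
  have e3 : ρ𝔤 ⁅X, Y⁆ (f ![⁅upqZ0 α β, Z⁆] : V) = μ • ρ𝔤 ⁅X, Y⁆ (f ![Z] : V) := by
    rw [← map_smul]
    congr 1
    exact apply_lie_upqZ0 ρK ρ𝔤 hV hf Z
  rw [e3] at e2
  calc (f ![⁅⁅Z, X⁆, Y⁆] : V) + μ • (f ![⁅⁅⁅upqZ0 α β, Z⁆, X⁆, Y⁆] : V) -
        ((f ![⁅⁅Z, Y⁆, X⁆] : V) + μ • (f ![⁅⁅⁅upqZ0 α β, Z⁆, Y⁆, X⁆] : V))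
      = ((f ![⁅⁅Z, X⁆, Y⁆] : V) - (f ![⁅⁅Z, Y⁆, X⁆] : V)) +
          μ • ((f ![⁅⁅⁅upqZ0 α β, Z⁆, X⁆, Y⁆] : V) - (f ![⁅⁅⁅upqZ0 α β, Z⁆, Y⁆, X⁆] : V)) := by
        rw [smul_sub]; abel
    _ = -ρ𝔤 ⁅X, Y⁆ (f ![Z] : V) + μ • -(μ • ρ𝔤 ⁅X, Y⁆ (f ![Z] : V)) := by rw [e1, e2]; rfl
    _ = 0 := by rw [smul_neg, smul_smul, hμ, neg_smul, one_smul, neg_neg, neg_add_cancel]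

include hV in
/-- **The defect has `z₀`-weight `2δi`**: `ρ(z₀) ρ(X) f(Y) = ρ(X)(δi f(Y)) + ρ(JX) f(Y) = 2δi · ρ(X) f(Y)` for `X ∈ 𝔭`
(nullity gives `ρ(JX) f(Y) = δi · ρ(X) f(Y)`). [cite: BorelWallach2000, II §4.1] -/
theorem z0_lie_apply (hδ : δ * δ = 1) (hf : f ∈ upqType ρK ρ𝔤 hV 1 δ)
    (hfN : ∀ (Y : Fin 1 → (uFormGroup α β).lie) (s : (α × β) × Fin 2),
      ⁅upqPBasis s, f Y⁆ + ((δ : ℂ) * Complex.I) • ⁅⁅upqZ0 α β, upqPBasis s⁆, f Y⁆ = 0)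
    (X Y : (uFormGroup α β).lie) (hX : X ∈ pPart α β) :
    ρ𝔤 (upqZ0 α β) (ρ𝔤 X (f ![Y] : V)) = (2 * ((δ : ℂ) * Complex.I)) • ρ𝔤 X (f ![Y] : V) := by
  set μ : ℂ := (δ : ℂ) * Complex.I with hμdef
  have hμ : μ * μ = -1 := deltaI_mul_deltaI hδ
  obtain ⟨-, hft⟩ := (mem_upqType_iff ρK ρ𝔤 hV 1 δ f).1 hf
  set v : V := (f ![Y] : V) with hvdef
  have hzv : ρ𝔤 (upqZ0 α β) v = μ • v := hft ![Y]
  have hnull : pOp ρ𝔤 μ X v = 0 := pOp_eq_zero_of_frame ρ𝔤 (fun s => hfN ![Y] s) X hX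
  rw [pOp_apply] at hnull
  have hJ : ρ𝔤 ⁅upqZ0 α β, X⁆ v = μ • ρ𝔤 X v := by
    have e : μ • (ρ𝔤 X v + μ • ρ𝔤 ⁅upqZ0 α β, X⁆ v) = 0 := by rw [hnull, smul_zero]
    rw [smul_add, smul_smul, hμ, neg_smul, one_smul, ← sub_eq_add_neg, sub_eq_zero] at e
    exact e.symm
  rw [lie_apply_apply ρ𝔤 (upqZ0 α β) X, hzv, map_smul, hJ, ← add_smul]
  congr 1
  ring

include hV in
/-- **§1 The defect of a null type-`δ` cochain lies in the null weight space `T_{2δi}(δi)`** (any pair datum).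
[cite: BorelWallach2000, II §4.1–4.2] -/
theorem lie_apply_sub_mem_nullWeightSpace (hδ : δ * δ = 1) (hf : f ∈ upqType ρK ρ𝔤 hV 1 δ)
    (hfN : ∀ (Y : Fin 1 → (uFormGroup α β).lie) (s : (α × β) × Fin 2),
      ⁅upqPBasis s, f Y⁆ + ((δ : ℂ) * Complex.I) • ⁅⁅upqZ0 α β, upqPBasis s⁆, f Y⁆ = 0)
    (X Y : (uFormGroup α β).lie) (hX : X ∈ pPart α β) (hY : Y ∈ pPart α β) :
    ρ𝔤 X (f ![Y] : V) - ρ𝔤 Y (f ![X] : V) ∈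
      nullWeightSpace ρ𝔤 ((δ : ℂ) * Complex.I) (2 * ((δ : ℂ) * Complex.I)) := by
  refine (mem_nullWeightSpace_iff ρ𝔤 _ _ _).2 ⟨fun s => ?_, ?_⟩
  · exact pOp_defect_eq_zero ρK ρ𝔤 hV hδ hf hfN _ X Y (upqPBasis_mem_pPart s) hX hY
  · rw [map_sub, z0_lie_apply ρK ρ𝔤 hV hδ hf hfN X Y hX, z0_lie_apply ρK ρ𝔤 hV hδ hf hfN Y X hY, smul_sub]

include hV in
/-- A non-zero value of a null type-`δ` cochain makes `T_{δi}(δi)` non-zero. [cite: BorelWallach2000, II §4.2 (3)] -/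
theorem nullWeightSpace_ne_bot_of_apply_ne_zero (hf : f ∈ upqType ρK ρ𝔤 hV 1 δ)
    (hfN : ∀ (Y : Fin 1 → (uFormGroup α β).lie) (s : (α × β) × Fin 2),
      ⁅upqPBasis s, f Y⁆ + ((δ : ℂ) * Complex.I) • ⁅⁅upqZ0 α β, upqPBasis s⁆, f Y⁆ = 0)
    {X₀ : (uFormGroup α β).lie} (hX₀ : f ![X₀] ≠ 0) :
    nullWeightSpace ρ𝔤 ((δ : ℂ) * Complex.I) ((δ : ℂ) * Complex.I) ≠ ⊥ := by
  obtain ⟨-, hft⟩ := (mem_upqType_iff ρK ρ𝔤 hV 1 δ f).1 hf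
  set v : V := (f ![X₀] : V) with hvdef
  have hmem : v ∈ nullWeightSpace ρ𝔤 ((δ : ℂ) * Complex.I) ((δ : ℂ) * Complex.I) :=
    (mem_nullWeightSpace_iff ρ𝔤 _ _ _).2 ⟨fun s => hfN ![X₀] s, hft ![X₀]⟩
  intro h
  rw [h, Submodule.mem_bot] at hmem
  exact hX₀ hmem
end Defect

/-! ## §2 The T3j converse: in an irreducible module null type-`δ` cochains are closed -/

section Closed
variable {δ : ℤ} {f : Cochain ℝ (uFormGroup α β).lie (GKCarrier (uFormGroup α β) ρ𝔤) 1}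

include hV in
/-- **T3j converse**: on an IRREDUCIBLE `(𝔤, K)`-module of `U(α, β)`, a `(𝔤, K)`-1-cochain of type `δ = ±1` whose values
are `𝔭^{−δ}`-null is CLOSED. [cite: BorelWallach2000, II §4.1–4.2; VI Thm. 4.11] -/
theorem d_eq_zero_of_isPNull (hirr : IsIrreducibleGK ρK ρ𝔤) (hδ : δ = 1 ∨ δ = -1) (hf : f ∈ upqType ρK ρ𝔤 hV 1 δ)
    (hfN : ∀ (Y : Fin 1 → (uFormGroup α β).lie) (s : (α × β) × Fin 2),
      ⁅upqPBasis s, f Y⁆ + ((δ : ℂ) * Complex.I) • ⁅⁅upqZ0 α β, upqPBasis s⁆, f Y⁆ = 0) :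
    d ℝ (uFormGroup α β).lie (GKCarrier (uFormGroup α β) ρ𝔤) 1 f = 0 := by
  by_cases hf0 : f = 0
  · rw [hf0, map_zero]
  have hδ1 : δ * δ = 1 := by rcases hδ with rfl | rfl <;> norm_num
  set μ : ℂ := (δ : ℂ) * Complex.I with hμdef
  have hμ : μ * μ = -1 := deltaI_mul_deltaI hδ1
  have hμ0 : μ ≠ 0 := fun h => by rw [h, mul_zero] at hμ; exact one_ne_zero (neg_eq_zero.1 hμ.symm)
  obtain ⟨hfc, hft⟩ := (mem_upqType_iff ρK ρ𝔤 hV 1 δ f).1 hf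
  obtain ⟨X₀, hX₀⟩ := cochainOne_exists_apply_ne_zero ρ𝔤 hf0
  have hT := nullWeightSpace_ne_bot_of_apply_ne_zero ρK ρ𝔤 hV hf hfN hX₀
  have h2 : nullWeightSpace ρ𝔤 μ (2 * μ) = ⊥ :=
    nullWeightSpace_eq_bot_of_ne hirr hV hμ hT (θ := 2 * μ) fun h => hμ0 (by
      have h' : 2 * μ - μ = 0 := sub_eq_zero.2 h
      have : 2 * μ - μ = μ := by ring
      rwa [this] at h')
  have hsym : ∀ X Y : (uFormGroup α β).lie, X ∈ pPart α β → Y ∈ pPart α β →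
      ρ𝔤 X (f ![Y] : V) - ρ𝔤 Y (f ![X] : V) = 0 := by
    intro X Y hX hY
    have h := lie_apply_sub_mem_nullWeightSpace ρK ρ𝔤 hV hδ1 hf hfN X Y hX hY
    rwa [h2, Submodule.mem_bot] at h
  -- the 2-cochain `df` vanishes on `(𝔨 + 𝔭) × (𝔨 + 𝔭)`
  set g := d ℝ (uFormGroup α β).lie (GKCarrier (uFormGroup α β) ρ𝔤) 1 f with hgdef
  have hg : ∀ x y : (uFormGroup α β).lie, g ![x, y] = ⁅x, f ![y]⁆ - ⁅y, f ![x]⁆ - f ![⁅x, y⁆] := fun x y =>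
    d_one_apply (R := ℝ) f x y
  have hK1 : ∀ W ∈ (uFormGroup α β).kInLie, ∀ y : (uFormGroup α β).lie, g ![W, y] = 0 := by
    intro W hW y
    rw [hg, apply_eq_zero_of_mem_kInLie ρK ρ𝔤 hV hfc hW, lie_zero, sub_zero, GKCarrier.bracket_def,
      ← lie_apply_of_mem_kInLie ρK ρ𝔤 hV hfc hW y]
    exact sub_self _
  have hK2 : ∀ (x : (uFormGroup α β).lie), ∀ W ∈ (uFormGroup α β).kInLie, g ![x, W] = 0 := by
    intro x W hW
    rw [hg, apply_eq_zero_of_mem_kInLie ρK ρ𝔤 hV hfc hW, lie_zero, zero_sub, ← lie_skew x W,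
      cochainOne_apply_neg ρ𝔤, GKCarrier.bracket_def, ← lie_apply_of_mem_kInLie ρK ρ𝔤 hV hfc hW x, sub_neg_eq_add]
    exact neg_add_cancel _
  have hPP : ∀ X Y : (uFormGroup α β).lie, X ∈ pPart α β → Y ∈ pPart α β → g ![X, Y] = 0 := by
    intro X Y hX hY
    rw [hg, apply_eq_zero_of_mem_kInLie ρK ρ𝔤 hV hfc (lie_mem_kInLie_of_mem_pPart X Y hX hY).1, sub_zero,
      GKCarrier.bracket_def, GKCarrier.bracket_def]
    exact hsym X Y hX hY
  -- bilinearity bookkeeping: `g(x, y) = (i_x g)(y)`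
  have hins : ∀ x y : (uFormGroup α β).lie, g ![x, y] = ins 1 x g ![y] := fun x y => by rw [ins_apply]
  have hPy : ∀ (X : (uFormGroup α β).lie), X ∈ pPart α β → ∀ y : (uFormGroup α β).lie, g ![X, y] = 0 := by
    intro X hX y
    obtain ⟨W', hW', c', rfl⟩ := upq_exists_kInLie_add_sum_upqPBasis y
    have hP' : (∑ s, c' s • upqPBasis s) ∈ pPart α β :=
      Submodule.sum_mem _ fun s _ => Submodule.smul_mem _ _ (upqPBasis_mem_pPart s)
    rw [hins, cochainOne_apply_add ρ𝔤, ← hins, ← hins, hK2 X W' hW', hPP X _ hX hP', add_zero]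
  refine (d_one_eq_zero_iff (R := ℝ) f).2 fun x y => ?_
  have h0 : g ![x, y] = 0 := by
    obtain ⟨W, hW, c, rfl⟩ := upq_exists_kInLie_add_sum_upqPBasis x
    have hP : (∑ s, c s • upqPBasis s) ∈ pPart α β :=
      Submodule.sum_mem _ fun s _ => Submodule.smul_mem _ _ (upqPBasis_mem_pPart s)
    rw [hins, ins_add, AlternatingMap.add_apply, ← hins, ← hins, hK1 W hW, hPy _ hP, add_zero]
  rw [hg] at h0
  -- `h0 : ⁅x, f y⁆ - ⁅y, f x⁆ - f ⁅x, y⁆ = 0`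
  exact (sub_eq_zero.1 h0).symm

include hV in
/-- **§3 Non-zero class**: on an IRREDUCIBLE `(𝔤, K)`-module of `U(α, β)`, a NON-ZERO `(𝔤, K)`-1-cochain of type
`δ = ±1` with `𝔭^{−δ}`-null values represents a non-zero class: `H¹_δ = upqTypeClasses … 1 δ ≠ ⊥` (no unitarity needed:
a coboundary `dv` of type `δ` has `v ∈ T₀(δi)`, incompatible with `T_{δi}(δi) ≠ 0`). [cite: BorelWallach2000, II §4.2, Thm. 4.8; VI Thm. 4.11] -/
theorem typeClasses_ne_bot_of_isPNull (hirr : IsIrreducibleGK ρK ρ𝔤) (hδ : δ = 1 ∨ δ = -1)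
    (hf : f ∈ upqType ρK ρ𝔤 hV 1 δ) (hf0 : f ≠ 0)
    (hfN : ∀ (Y : Fin 1 → (uFormGroup α β).lie) (s : (α × β) × Fin 2),
      ⁅upqPBasis s, f Y⁆ + ((δ : ℂ) * Complex.I) • ⁅⁅upqZ0 α β, upqPBasis s⁆, f Y⁆ = 0) :
    upqTypeClasses ρK ρ𝔤 hV 1 δ ≠ ⊥ := by
  have hδ1 : δ * δ = 1 := by rcases hδ with rfl | rfl <;> norm_num
  set μ : ℂ := (δ : ℂ) * Complex.I with hμdef
  have hμ : μ * μ = -1 := deltaI_mul_deltaI hδ1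
  have hμ0 : μ ≠ 0 := fun h => by rw [h, mul_zero] at hμ; exact one_ne_zero (neg_eq_zero.1 hμ.symm)
  obtain ⟨hfc, hft⟩ := (mem_upqType_iff ρK ρ𝔤 hV 1 δ f).1 hf
  have hd := d_eq_zero_of_isPNull ρK ρ𝔤 hV hirr hδ hf hfN
  obtain ⟨X₀, hX₀⟩ := cochainOne_exists_apply_ne_zero ρ𝔤 hf0
  have hT := nullWeightSpace_ne_bot_of_apply_ne_zero ρK ρ𝔤 hV hf hfN hX₀
  set S := gkComplex (uFormGroup α β) ρK ρ𝔤 hV with hSdef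
  have hz : f ∈ S.cocycles 1 := (S.mem_cocycles_iff 1 f).2 ⟨hfc, hd⟩
  have hzt : (⟨f, hz⟩ : S.cocycles 1) ∈ (upqType ρK ρ𝔤 hV 1 δ).comap (S.cocycles 1).subtype :=
    Submodule.mem_comap.2 hf
  have hx : S.toCohomology 1 ⟨f, hz⟩ ∈ upqTypeClasses ρK ρ𝔤 hV 1 δ := Submodule.mem_map_of_mem hzt
  intro hbot
  rw [hbot, Submodule.mem_bot, S.toCohomology_eq_zero_iff 1] at hx
  obtain ⟨g, hg, hgf⟩ := (S.mem_coboundaries_succ_iff 0 f).1 hx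
  -- `f(X) = ρ(X) v` with `v = g()` a `𝔨`-invariant vector
  set v : V := (g ![] : V) with hvdef
  have hfX : ∀ X : (uFormGroup α β).lie, (f ![X] : V) = ρ𝔤 X v := fun X => by
    rw [← hgf, d_zero_apply_one, GKCarrier.bracket_def]
  have hg0 : ∀ W ∈ (uFormGroup α β).kInLie, ρ𝔤 W v = 0 := by
    intro W hW
    have h := hg
    rw [hSdef, gkComplex, Subcomplex.mem_gK_iff, Subcomplex.mem_rel_zero_iff] at h
    have e := congrArg (fun φ : Cochain ℝ (uFormGroup α β).lie (GKCarrier (uFormGroup α β) ρ𝔤) 0 => φ ![]) (h.1 W hW)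
    simp only [lieDer_zero_apply, AlternatingMap.zero_apply, GKCarrier.bracket_def] at e
    exact e
  -- `ρ(JX) v = μ ρ(X) v` (the type, read through `f(X) = ρ(X) v` and `ρ(z₀) v = 0`)
  have hJ : ∀ X : (uFormGroup α β).lie, ρ𝔤 ⁅upqZ0 α β, X⁆ v = μ • ρ𝔤 X v := fun X => by
    have e1 := lie_apply_apply ρ𝔤 (upqZ0 α β) X v
    rw [hg0 _ upqZ0_mem_kInLie, map_zero, zero_add] at e1
    have e2 : ρ𝔤 (upqZ0 α β) (ρ𝔤 X v) = μ • ρ𝔤 X v := by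
      rw [← hfX]
      exact hft ![X]
    rw [e1] at e2
    exact e2
  -- `v ∈ T₀(μ)`
  have hv : v ∈ nullWeightSpace ρ𝔤 μ 0 := by
    refine (mem_nullWeightSpace_iff ρ𝔤 _ _ _).2 ⟨fun s => ?_, ?_⟩
    · rw [pOp_apply, hJ, smul_smul, hμ, neg_smul, one_smul, add_neg_cancel]
    · rw [hg0 _ upqZ0_mem_kInLie, zero_smul]
  have hv0 : v ≠ 0 := by
    intro h0
    apply hX₀
    rw [hfX, h0, map_zero]
    rfl
  have hT0 : nullWeightSpace ρ𝔤 μ 0 ≠ ⊥ := fun h => by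
    rw [h, Submodule.mem_bot] at hv
    exact hv0 hv
  exact hT0 (nullWeightSpace_eq_bot_of_ne hirr hV hμ hT (θ := 0) fun h => hμ0 h.symm)
end Closed

/-! ## §4 Packaging: an equivariant horizontal real-linear map `𝔤 → V` is a `(𝔤, K)`-1-cochain -/

section Packaging
include hV in
/-- **A `K`- and `𝔨`-equivariant real-linear map `φ : 𝔤 → V` vanishing on `𝔨` is the value function of a
`(𝔤, K)`-1-cochain** (`θ_W f = 0`, `i_W f = 0` for `W ∈ 𝔨`, `k • f = f`; ★ `mem_gkComplex_succ_iff`).  Its type is then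
read off from the `z₀`-weights of the values by ★ `mem_upqType_iff`. [cite: BorelWallach2000, I §5.1 (1)–(3)] -/
theorem exists_gkCochain_of_linearMap (φ : (uFormGroup α β).lie →ₗ[ℝ] V)
    (h0 : ∀ W ∈ (uFormGroup α β).kInLie, φ W = 0)
    (hK : ∀ (k : (uFormGroup α β).maximalCompact) (X : (uFormGroup α β).lie),
      ρK k (φ X) = φ ((uFormGroup α β).Ad (Subgroup.inclusion (uFormGroup α β).maximalCompact_le_carrier k) X))
    (h𝔨 : ∀ W ∈ (uFormGroup α β).kInLie, ∀ X : (uFormGroup α β).lie, φ ⁅W, X⁆ = ρ𝔤 W (φ X)) :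
    ∃ f : Cochain ℝ (uFormGroup α β).lie (GKCarrier (uFormGroup α β) ρ𝔤) 1,
      f ∈ (gkComplex (uFormGroup α β) ρK ρ𝔤 hV).carrier 1 ∧ ∀ X : (uFormGroup α β).lie, (f ![X] : V) = φ X := by
  let φ' : (uFormGroup α β).lie →ₗ[ℝ] GKCarrier (uFormGroup α β) ρ𝔤 :=
    ((GKCarrier.of (uFormGroup α β) ρ𝔤).restrictScalars ℝ).toLinearMap ∘ₗ φ
  let f : Cochain ℝ (uFormGroup α β).lie (GKCarrier (uFormGroup α β) ρ𝔤) 1 :=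
    AlternatingMap.ofSubsingleton ℝ (uFormGroup α β).lie (GKCarrier (uFormGroup α β) ρ𝔤) (0 : Fin 1) φ'
  have hf : ∀ X : (uFormGroup α β).lie, (f ![X] : V) = φ X := fun X => rfl
  refine ⟨f, (mem_gkComplex_succ_iff (uFormGroup α β) ρK ρ𝔤 hV 0 f).2 ⟨fun W hW => ⟨?_, ?_⟩, fun k => ?_⟩, hf⟩
  · refine cochainOne_eq_zero ρ𝔤 fun Y => ?_
    rw [lieDer_one_apply, GKCarrier.bracket_def, sub_eq_zero]
    change ρ𝔤 W (φ Y) = φ ⁅W, Y⁆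
    rw [h𝔨 W hW Y]
  · ext v
    rw [ins_apply, AlternatingMap.zero_apply]
    change φ (Matrix.vecCons W v 0) = 0
    exact h0 W hW
  · have h := cochainOne_eq_zero ρ𝔤 (f := (gkPairAction (uFormGroup α β) ρK ρ𝔤 hV).act k 1 f - f) fun Y => by
      rw [AlternatingMap.sub_apply, PairAction.act_apply, sub_eq_zero]
      change ρK k (φ ((gkPairAction (uFormGroup α β) ρK ρ𝔤 hV).σ k⁻¹ Y)) = φ Y
      rw [hK]
      exact congrArg φ ((gkPairAction (uFormGroup α β) ρK ρ𝔤 hV).σ_inv_apply k Y)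
    exact sub_eq_zero.1 h

include hV in
/-- **Corollary (the rung-1 junction in one statement)**: on an IRREDUCIBLE `(𝔤, K)`-module of `U(α, β)`, a non-zero
real-linear `φ : 𝔤 → V` vanishing on `𝔨`, `K`- and `𝔨`-equivariant, with values of `z₀`-weight `δi` (`δ = ±1`) that are
`𝔭^{−δ}`-null, gives `H¹_δ(𝔤, K; V) ≠ 0`. [cite: BorelWallach2000, II §4.2, VI Thm. 4.11; Rogawski1990, §15.2] -/
theorem typeClasses_ne_bot_of_linearMap (hirr : IsIrreducibleGK ρK ρ𝔤) {δ : ℤ} (hδ : δ = 1 ∨ δ = -1)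
    (φ : (uFormGroup α β).lie →ₗ[ℝ] V) (hφ0 : φ ≠ 0)
    (h0 : ∀ W ∈ (uFormGroup α β).kInLie, φ W = 0)
    (hK : ∀ (k : (uFormGroup α β).maximalCompact) (X : (uFormGroup α β).lie),
      ρK k (φ X) = φ ((uFormGroup α β).Ad (Subgroup.inclusion (uFormGroup α β).maximalCompact_le_carrier k) X))
    (h𝔨 : ∀ W ∈ (uFormGroup α β).kInLie, ∀ X : (uFormGroup α β).lie, φ ⁅W, X⁆ = ρ𝔤 W (φ X))
    (hwt : ∀ X : (uFormGroup α β).lie, ρ𝔤 (upqZ0 α β) (φ X) = ((δ : ℂ) * Complex.I) • φ X)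
    (hN : ∀ (X : (uFormGroup α β).lie) (s : (α × β) × Fin 2),
      ρ𝔤 (upqPBasis s) (φ X) + ((δ : ℂ) * Complex.I) • ρ𝔤 ⁅upqZ0 α β, upqPBasis s⁆ (φ X) = 0) :
    upqTypeClasses ρK ρ𝔤 hV 1 δ ≠ ⊥ := by
  obtain ⟨f, hfc, hf⟩ := exists_gkCochain_of_linearMap ρK ρ𝔤 hV φ h0 hK h𝔨
  have hfv : ∀ v : Fin 1 → (uFormGroup α β).lie, (f v : V) = φ (v 0) := fun v => by
    have e : v = ![v 0] := by funext i; fin_cases i; rfl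
    rw [e]; exact hf (v 0)
  have hft : f ∈ upqType ρK ρ𝔤 hV 1 δ :=
    (mem_upqType_iff ρK ρ𝔤 hV 1 δ f).2 ⟨hfc, fun v => by rw [hfv]; exact hwt (v 0)⟩
  have hf0 : f ≠ 0 := by
    intro h
    apply hφ0
    ext X
    rw [← hf X, h, AlternatingMap.zero_apply, LinearMap.zero_apply]
    rfl
  refine typeClasses_ne_bot_of_isPNull ρK ρ𝔤 hV hirr hδ hft hf0 fun Y s => ?_
  rw [GKCarrier.bracket_def, GKCarrier.bracket_def, hfv]
  exact hN (Y 0) s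
end Packaging

end Summit.HodgeConjecture.HodgeConjecture.Cruxes.H413.F0P3PNullMapIsCocycle

end
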